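/-
Copyright: cell `pub-ymgap` (HUMAN RULING D-0062), Track A of `YM-PLAN.md`, DAG node N20 (= NE7b); R134 acceleration seat
`pub-ymgap-dag-n20-c` (strategy s1, generation 13), module 57.  Released under the licence of the surrounding project.
-/
import Summits.QuantumFields.YangMills.Theorems.BalabanUVNodesN20LCSChiClassSocket
import Summits.QuantumFields.YangMills.Theorems.BalabanUVNodesK0VariationalThm1Top7Engine
import HarnessLib

/-!
# YM-DAG node N20 (= NE7b), row s1, module 57: THE CORNER OF `Ω₁(□₀^{∼4})` AT A PINNED LEVEL 0 — the pieces of the K0 ROW P11 corner engine for module 56's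
# socket (T♯): the corner plaquette and the bond entering it, the LOCAL action of a single-bond field, a def-R-CLASS small-action minimiser

Track A of `YM-PLAN.md` (cell `pub-ymgap`, HUMAN RULING D-0062), node **N20** = spine estimate NE7b (`T4WeightBudget.RelWeightBound`, NOT PRINTED, NOT PROVED).
Seat `pub-ymgap-dag-n20-c` (R134, s1), generation 13, module 57 (imports module 56 `…N20LCSChiClassSocket` and the K0 ROW P11 negative lane's
`…K0VariationalThm1Top7Engine` chain — dag-n21-c g7–g10, dag-n07-e g6–g7 — BY NAME; nothing of theirs restated).

WHY.  Module 56 displays the row's instance modulo (W♮) + (T♯), (T♯) = `hχ` = «[15] Thm 1 (R) at the top scale for def-R's χ-CLASS local problem at every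
χ_{j+1}-cube» in NODE 00's grammar — binder for binder the body of def-P11's `VariationalThm1RegSepTop7M` at the local sequence `maxDomT ν.M₁ □_c^{∼4}`, def-R's uniform
class, constant thresholds, top member (HOME `N20-T-SOCKET.md` §1).  The K0 ROW P11 negative lane certifies CORNER FLOORS (`2L² ≤ B₃`) for every `…Top7M`-type sentence:
at the top index the conclusion (8) ranges over the plaquettes MEETING the top domain (p.77 convention), and a fine plaquette meeting `Ω₁` at one corner has all four bonds
in `Γ₀ = Ω₁ᶜ` ([III] (2.2), `gammaRegion … 0`), where the fibre PINS the configuration to the datum.  (T♯) was never run through that engine; module 58 does it at a pinned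
LEVEL `j = 0` (top scale `1`).  THIS module supplies the pieces at the socket's OWN objects (torus `F.P K`, local sequence `maxDomT M₁ (cubeEnl P s 0 4)`, def-R's class).
CONTENTS (THEOREMS ONLY; 0 `def`, 0 `instance`, 0 `sorry`).  §1 `cornerIdx_spec` (the corner index `u = ⌊(4s − s₁ + 1)∕s₁⌋`, `s₁ = L·M₁ ≤ s`); `corner_mem_maxDom`,
`notMem_maxDom_of_coord` (on the cover ℤᵈ, r11's `mem_maxDom_succ` + `cover_eq_cover_iff`: `z⁰ = −s₁u·(e_{μ₀}+e_{ν₁}) ∈ Ω₁(□₀^{∼4})` and every point with a coordinate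
`−s₁u − 1` is off it; letter: the 4-collar does not wrap, `9s + s₁ ≤ 2L^{m+K}`); ★ `exists_cornerPlaq` (on the torus, r11's `preimage_maxDomT`, letter `s₁ ∣ 2L^{m+K}`: the
corner plaquette `⟨π(z⁰−e_{μ₀}−e_{ν₁}); μ₀, ν₁⟩` — far corner in `Ω₁`, three near corners off it — TOGETHER WITH a coarse site `y₁` placing `x′ = π(z⁰ − e_{μ₀})`, the source of
the bond ENTERING `Ω₁`, at the block position asked by the impulse-response lemma `K0AveragedSingleBondFloor.dist1_avgFun_single_star_le` (`z⁰ ∈ s₁ℤᵈ ⊆ Lℤᵈ`; computed with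
`T4Covariance`'s `Site.emb_apply_eq` ∕ `Site.scaleCoord`).  §2 ★ `wilsonAction4_single_le`: the action of a single-bond field is LOCAL, `A ≤ 2d·(dist1 h)²` (the touched
plaquettes inject into `Bool × Fin d`; dag-n07-e's `wilsonAction4_le_card_mul_sq` is the volume form).  §3 ★ `exists_isMinimizer_plaqSmall_of_smallAction`: dag-n07-e's
small-action boundary avoidance RE-KEYED on def-R's UNIFORM class `{PlaqSmall θ}`, `θ < α₀η_k²` (direct method of `N07DirectMethodDetSet` over `closure {PlaqSmall θ} ⊆ bgReg … k α₀`).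
HONEST FRAMING: lattice bookkeeping and one existence lemma about the TREE's own objects; nothing of Bałaban asserted or refuted; (W♮) untouched; N20 NOT discharged;
NE7b NOT PRINTED ∕ NOT PROVED; nothing continuum ∕ ℝ⁴ ∕ OS ∕ mass-gap ∕ Clay; counts unmoved.
DEPENDENCES (by name): r11 `B14.Eq213MaximalDomains.(mem_maxDom_succ, side_pos)`, `B14.Eq213DetSet.preimage_maxDomT`, `B14DomainGeom.(cubeIdx_le, lt_cubeIdx)`,
`B15Eq112TorusCover.(cover_eq_cover_iff, cover_apply)`, `Site.(emb_apply_eq, scaleCoord_one, two_mul_half_add_one_cast, unshift_shift)` (`T4Covariance`), def-R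
`Node00.(cubeEnl, cubeExt)`, `B15DeterminingSets.(genSet, gammaRegion_of_gt)`, K0 ROW P11 ∕ N07 lanes: `K0BgProvisoOverRange.shift_cover`,
`N07Thm1ScaledInterfaceInstance.dist1_plaqHol_single_le`, `N07DirectMethod.closure_plaqSmall_subset_plaqSmall`, `N07DirectMethodDetSet.(exists_isMinimizer_of_isClosed,
isMinimizer_of_isMinimizer_closure_of_mem)`, `N07SmallActionBoundaryAvoidance.dist1_plaqHol_lt_of_wilsonAction4_lt`, `B8Eq110UnitaryProof.cmp_specialUnitaryGroup`, `Node00.bgReg`.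
-/

noncomputable section

open scoped BigOperators

namespace Summit.QuantumFields.YangMills.BalabanUVNodes.N20LCSChiClassSocketCorner

open Literature.MathematicalPhysics.QuantumFieldTheory.Balaban1983to89
open Literature.MathematicalPhysics.QuantumFieldTheory.Balaban1983to89.T4Continuum
open Literature.MathematicalPhysics.QuantumFieldTheory.Balaban1983to89.Node00
open B15DeterminingSets B14.Eq213DetSet B14.Eq213MaximalDomains B15Eq112TorusCover B14DomainGeom B15LatticeCubeTorus
open Summit.QuantumFields.YangMills.Theorems.K0BgProvisoOverRange (shift_cover)
open Summit.QuantumFields.YangMills.BalabanUVNodes.N07Thm1ScaledInterfaceInstance (dist1_plaqHol_single_le)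
open Summit.QuantumFields.YangMills.BalabanUVNodes.N07DirectMethod (closure_plaqSmall_subset_plaqSmall)
open Summit.QuantumFields.YangMills.BalabanUVNodes.N07DirectMethodDetSet (exists_isMinimizer_of_isClosed
  isMinimizer_of_isMinimizer_closure_of_mem)
open Summit.QuantumFields.YangMills.BalabanUVNodes.N07SmallActionBoundaryAvoidance (dist1_plaqHol_lt_of_wilsonAction4_lt)
open B8Eq110UnitaryProof (cmp_specialUnitaryGroup)
open scoped Matrix.Norms.L2Operator

/-! ## §1  The corner of `Ω₁(□₀^{∼4})`: arithmetic of the corner index and the four memberships, on the cover and on the torus -/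

section Corner

variable {P : Params}

/-- The corner index `u := (4s − s₁ + 1)/s₁` of the first maximal domain of the 4-collar `[−4s, 5s−1]ᵈ` for cubes of side `s₁ ≤ s`: `s₁u ≤ 4s − s₁ + 1 < s₁u + s₁`
and `u ≥ 1`, as INTEGER inequalities. [cite: Balaban1988Convergent, (2.13) pp.256–257 (bookkeeping)] -/
theorem cornerIdx_spec {s₁ s : ℕ} (h1 : 0 < s₁) (hs : s₁ ≤ s) :
    ((s₁ : ℤ) * ((4 * s - s₁ + 1) / s₁ : ℕ) ≤ 4 * s - s₁ + 1) ∧ (4 * (s : ℤ) - s₁ + 1 < s₁ * ((4 * s - s₁ + 1) / s₁ : ℕ) + s₁) ∧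
      1 ≤ (4 * s - s₁ + 1) / s₁ := by
  set a : ℕ := 4 * s - s₁ + 1 with ha
  have hcast : ((a : ℕ) : ℤ) = 4 * (s : ℤ) - s₁ + 1 := by rw [ha]; omega
  refine ⟨?_, ?_, ?_⟩
  · have h : s₁ * (a / s₁) ≤ a := Nat.mul_div_le a s₁
    have h' : (s₁ : ℤ) * ((a / s₁ : ℕ) : ℤ) ≤ (a : ℤ) := by exact_mod_cast h
    linarith [h', hcast]
  · have h : a < a / s₁ * s₁ + s₁ := Nat.lt_div_mul_add h1
    have h' : (a : ℤ) < ((a / s₁ : ℕ) : ℤ) * (s₁ : ℤ) + s₁ := by exact_mod_cast h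
    linarith [h', hcast]
  · exact (Nat.le_div_iff_mul_le h1).2 (by omega)

/-- **THE FAR CORNER LIES IN `Ω₁(□₀^{∼4})`** (on the cover): the point `z⁰ = −s₁u·(e_{μ₀} + e_{ν₁})`, `s₁ = L·M₁`, `u` the corner index, belongs to the first maximal
domain `maxDom L M₁ (π⁻¹ □₀^{∼4}) 1` of the pull-back of the torus 4-collar `□₀^{∼4} = cubeEnl P s 0 4` (every point within `s₁ − 1` of its `s₁`-cube lies in the box
`[−4s, 5s−1]ᵈ`). [cite: Balaban1988Convergent, (2.13) pp.256–257, (2.16)–(2.17) p.257] -/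
theorem corner_mem_maxDom {M₁ s : ℕ} (hM : 1 ≤ M₁) (hs : side P.L M₁ 1 ≤ s) (μ0 ν₁ : Fin P.d) :
    (fun i => if i = μ0 ∨ i = ν₁ then -(((side P.L M₁ 1 * ((4 * s - side P.L M₁ 1 + 1) / side P.L M₁ 1) : ℕ) : ℤ)) else 0)
      ∈ maxDom P.L M₁ (cover P ⁻¹' cubeEnl P s 0 4) 1 := by
  set s₁ : ℕ := side P.L M₁ 1 with hs₁
  set u : ℕ := (4 * s - s₁ + 1) / s₁ with hu
  have h1 : 0 < s₁ := side_pos P.L_pos hM 1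
  have h1' : (0 : ℤ) < s₁ := by exact_mod_cast h1
  obtain ⟨hu1, hu2, hu3⟩ := cornerIdx_spec h1 hs
  rw [mem_maxDom_succ]
  intro x' hx' y hy
  refine ⟨y, fun i => ?_, rfl⟩
  have hci : cubeIdx s₁ x' i = if i = μ0 ∨ i = ν₁ then -(u : ℤ) else 0 := by
    have := congrFun hx' i
    rw [← hs₁] at this
    rw [this]
    show (if i = μ0 ∨ i = ν₁ then -(((s₁ * u : ℕ) : ℤ)) else 0) / (s₁ : ℤ) = _
    by_cases h : i = μ0 ∨ i = ν₁
    · rw [if_pos h, if_pos h, show -(((s₁ * u : ℕ) : ℤ)) = (s₁ : ℤ) * (-(u : ℤ)) by push_cast; ring]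
      exact Int.mul_ediv_cancel_left _ h1'.ne'
    · rw [if_neg h, if_neg h, Int.zero_ediv]
  have hlo := cubeIdx_le s₁ h1 x' i
  have hhi := lt_cubeIdx s₁ h1 x' i
  have hyi := abs_le.1 (hy i)
  rw [← hs₁] at hyi
  have hc0 : -(u : ℤ) ≤ cubeIdx s₁ x' i ∧ cubeIdx s₁ x' i ≤ 0 := by
    rw [hci]; split_ifs <;> constructor <;> linarith
  have hsc1 : -((s₁ : ℤ) * u) ≤ (s₁ : ℤ) * cubeIdx s₁ x' i := by nlinarith [hc0.1, h1']
  have hsc2 : (s₁ : ℤ) * cubeIdx s₁ x' i ≤ 0 := by nlinarith [hc0.2, h1']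
  have hs1s : (s₁ : ℤ) ≤ s := by exact_mod_cast hs
  show (s : ℤ) * (0 : Pt P.d) i - ((4 * s : ℕ) : ℤ) ≤ y i ∧ y i ≤ (s : ℤ) * (0 : Pt P.d) i + s - 1 + ((4 * s : ℕ) : ℤ)
  simp only [Pi.zero_apply, mul_zero, zero_sub, zero_add]
  push_cast
  constructor <;> linarith

/-- **A POINT JUST BELOW THE CORNER IS OFF `Ω₁(□₀^{∼4})`** (on the cover): any `w` with a coordinate `w_μ = −s₁u − 1` lies outside `maxDom L M₁ (π⁻¹ □₀^{∼4}) 1`,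
provided the 4-collar does not wrap the torus (`9s + s₁ ≤ 2L^{m+K}`): the `s₁`-cube of `w` in direction `μ` has a point within `s₁ − 1` whose `μ`-coordinate
`1 − s₁u − 2s₁ ∈ [−4s − s₁, −4s − 1]` is matched by NO deck translate of `[−4s, 5s−1]`. [cite: Balaban1988Convergent, (2.13) pp.256–257, (2.16)–(2.17) p.257] -/
theorem notMem_maxDom_of_coord {M₁ s : ℕ} (hM : 1 ≤ M₁) (hs : side P.L M₁ 1 ≤ s) (hwrap : 9 * s + side P.L M₁ 1 ≤ P.sitesPerDir 0)
    (w : Pt P.d) (μ : Fin P.d) (hw : w μ = -(((side P.L M₁ 1 * ((4 * s - side P.L M₁ 1 + 1) / side P.L M₁ 1) : ℕ) : ℤ)) - 1) :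
    w ∉ maxDom P.L M₁ (cover P ⁻¹' cubeEnl P s 0 4) 1 := by
  set s₁ : ℕ := side P.L M₁ 1 with hs₁
  set u : ℕ := (4 * s - s₁ + 1) / s₁ with hu
  set T : ℕ := P.sitesPerDir 0 with hT
  have h1 : 0 < s₁ := side_pos P.L_pos hM 1
  have h1' : (0 : ℤ) < s₁ := by exact_mod_cast h1
  obtain ⟨hu1, hu2, -⟩ := cornerIdx_spec h1 hs
  have hs1s : (s₁ : ℤ) ≤ s := by exact_mod_cast hs
  have hTw : 9 * (s : ℤ) + s₁ ≤ T := by exact_mod_cast hwrap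
  have hw' : w μ = -((s₁ : ℤ) * u) - 1 := by rw [hw]; push_cast; ring
  rw [mem_maxDom_succ]
  push Not
  -- the cube-mate `x″` (lowest `μ`-coordinate of `w`'s cube) and the witness `y = x″ − (s₁ − 1)e_μ`
  refine ⟨Function.update w μ (-((s₁ : ℤ) * u) - s₁), ?_, Function.update w μ (1 - (s₁ : ℤ) * u - 2 * s₁), ?_, ?_⟩
  · funext i
    unfold cubeIdx
    by_cases hi : i = μ
    · subst hi
      rw [Function.update_self, hw', ← hs₁]
      have e1 : (-((s₁ : ℤ) * u) - s₁) / (s₁ : ℤ) = -(u : ℤ) - 1 := by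
        rw [show -((s₁ : ℤ) * u) - s₁ = (s₁ : ℤ) * (-(u : ℤ) - 1) by ring]
        exact Int.mul_ediv_cancel_left _ h1'.ne'
      have e2 : (-((s₁ : ℤ) * u) - 1) / (s₁ : ℤ) = -(u : ℤ) - 1 := by
        rw [show -((s₁ : ℤ) * u) - 1 = ((s₁ : ℤ) - 1) + (s₁ : ℤ) * (-(u : ℤ) - 1) by ring, Int.add_mul_ediv_left _ _ h1'.ne',
          Int.ediv_eq_zero_of_lt (by linarith) (by linarith), zero_add]
      rw [e1, e2]
    · rw [Function.update_of_ne hi, ← hs₁]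
  · intro i
    rw [← hs₁]
    by_cases hi : i = μ
    · subst hi; rw [Function.update_self, Function.update_self]
      rw [show -((s₁ : ℤ) * u) - s₁ - (1 - (s₁ : ℤ) * u - 2 * s₁) = (s₁ : ℤ) - 1 by ring, abs_of_nonneg (by linarith)]
    · rw [Function.update_of_ne hi, Function.update_of_ne hi, sub_self, abs_zero]; linarith
  · rintro ⟨b, hb, hcov⟩
    obtain ⟨v, hv⟩ := (cover_eq_cover_iff b _).1 hcov
    have hbμ : (s : ℤ) * (0 : Pt P.d) μ - ((4 * s : ℕ) : ℤ) ≤ b μ ∧ b μ ≤ (s : ℤ) * (0 : Pt P.d) μ + s - 1 + ((4 * s : ℕ) : ℤ) := hb μ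
    simp only [Pi.zero_apply, mul_zero, zero_sub, zero_add] at hbμ
    push_cast at hbμ
    have hvμ := congrFun hv μ
    simp only [Function.update_self, Pi.add_apply, pmul, per] at hvμ
    rw [← hT] at hvμ
    have hT0 : (0 : ℤ) < T := by linarith
    rcases lt_trichotomy (v μ) 0 with hv0 | hv0 | hv0
    · have hv1 : v μ ≤ -1 := by omega
      have : (T : ℤ) * v μ ≤ -T := by nlinarith
      linarith [hbμ.1, hbμ.2]
    · rw [hv0, mul_zero, add_zero] at hvμ
      linarith [hbμ.1, hbμ.2]
    · have hv1 : 1 ≤ v μ := by omega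
      have : (T : ℤ) ≤ (T : ℤ) * v μ := by nlinarith
      linarith [hbμ.1, hbμ.2]

/-- ★ **THE CORNER PLAQUETTE OF `Ω₁(□₀^{∼4})` AND THE BOND ENTERING IT, ON THE TORUS.**  For cubes of side `s₁ = L·M₁ ≤ s` partitioning the torus (`s₁ ∣ 2L^{m+K}`),
a 4-collar `□₀^{∼4} = cubeEnl P s 0 4` that does not wrap (`9s + s₁ ≤ 2L^{m+K}`) and directions `μ₀ < ν₁`: there is a fine plaquette `p = ⟨π(z⁰ − e_{μ₀} − e_{ν₁}); μ₀, ν₁⟩`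
whose FAR corner `π z⁰` lies in the first maximal domain `Ω₁ = maxDomT M₁ □₀^{∼4} 1` of (2.13) while its three NEAR corners do not (so all four of its bonds meet
`Γ₀ = Ω₁ᶜ`, [III] (2.2)), together with a coarse site `y₁` such that the fine site `x′ = π(z⁰ − e_{μ₀})` — the source of the bond `⟨x′, μ₀⟩` ENTERING `Ω₁` at `π z⁰` — sits
in the block `B(y₁)` at the position the (0.4) impulse-response lemma `K0AveragedSingleBondFloor.dist1_avgFun_single_star_le` asks for (`x′_{μ₀} = (emb y₁)_{μ₀} + (L−1)/2`,
`x′_κ + (L−1)/2 = (emb y₁)_κ` for `κ ≠ μ₀`; here `z⁰ ∈ s₁ℤᵈ ⊆ Lℤᵈ`). [cite: Balaban1988Convergent, (2.2) p.255, (2.13) pp.256–257, (2.16)–(2.17) p.257; Balaban1987RG1, (0.1) p.251, (0.4) p.253] -/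
theorem exists_cornerPlaq {M₁ s : ℕ} (hM : 1 ≤ M₁) (hs : side P.L M₁ 1 ≤ s) (hdiv : side P.L M₁ 1 ∣ P.sitesPerDir 0)
    (hwrap : 9 * s + side P.L M₁ 1 ≤ P.sitesPerDir 0) {μ0 ν₁ : Fin P.d} (hμν : μ0 < ν₁) :
    ∃ (p : Plaq P 0) (y₁ : Site P 1), p.μ = μ0 ∧
      (p.src.shift p.μ).shift p.ν ∈ maxDomT M₁ (cubeEnl P s 0 4) 1 ∧ p.src ∉ maxDomT M₁ (cubeEnl P s 0 4) 1 ∧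
      p.src.shift p.μ ∉ maxDomT M₁ (cubeEnl P s 0 4) 1 ∧ p.src.shift p.ν ∉ maxDomT M₁ (cubeEnl P s 0 4) 1 ∧
      (p.src.shift p.ν) μ0 = emb y₁ μ0 + (((P.L - 1) / 2 : ℕ) : ZMod (P.sitesPerDir 0)) ∧
      (∀ κ, κ ≠ μ0 → (p.src.shift p.ν) κ + (((P.L - 1) / 2 : ℕ) : ZMod (P.sitesPerDir 0)) = emb y₁ κ) := by
  have hne : μ0 ≠ ν₁ := ne_of_lt hμν
  set s₁ : ℕ := side P.L M₁ 1 with hs₁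
  set u : ℕ := (4 * s - s₁ + 1) / s₁ with hu
  set U : ℤ := ((s₁ * u : ℕ) : ℤ) with hU
  -- the near corner `w₀ = z⁰ − e_{μ₀} − e_{ν₁}` and its shifts
  set w₀ : Pt P.d := fun i => if i = μ0 ∨ i = ν₁ then -U - 1 else 0 with hw₀
  have hsh1 : (cover P w₀).shift μ0 = cover P (fun i => if i = ν₁ then -U - 1 else if i = μ0 then -U else 0) := by
    rw [shift_cover]; congr 1; funext i
    by_cases hiμ : i = μ0
    · subst hiμ; rw [Function.update_self, if_neg hne, if_pos rfl, hw₀]; simp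
    · rw [Function.update_of_ne hiμ, if_neg hiμ, hw₀]
      by_cases hiν : i = ν₁
      · simp [hiν]
      · simp [hiμ, hiν]
  have hsh2 : (cover P w₀).shift ν₁ = cover P (fun i => if i = μ0 then -U - 1 else if i = ν₁ then -U else 0) := by
    rw [shift_cover]; congr 1; funext i
    by_cases hiν : i = ν₁
    · subst hiν; rw [Function.update_self, if_neg (Ne.symm hne), if_pos rfl, hw₀]; simp
    · rw [Function.update_of_ne hiν, if_neg hiν, hw₀]
      by_cases hiμ : i = μ0
      · simp [hiμ]
      · simp [hiμ, hiν]
  have hsh12 : ((cover P w₀).shift μ0).shift ν₁ = cover P (fun i => if i = μ0 ∨ i = ν₁ then -U else 0) := by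
    rw [hsh1, shift_cover]; congr 1; funext i
    by_cases hiν : i = ν₁
    · subst hiν; rw [Function.update_self, if_pos rfl, if_pos (Or.inr rfl)]; ring
    · rw [Function.update_of_ne hiν, if_neg hiν]
      by_cases hiμ : i = μ0
      · simp [hiμ]
      · simp [hiμ, hiν]
  -- the torus memberships are decided on the cover
  have key : ∀ w : Pt P.d, cover P w ∈ maxDomT M₁ (cubeEnl P s 0 4) 1 ↔ w ∈ maxDom P.L M₁ (cover P ⁻¹' cubeEnl P s 0 4) 1 := fun w => by
    rw [← Set.mem_preimage, preimage_maxDomT hM hdiv le_rfl]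
  -- the coarse site `y₁` (block coordinates of `x′ = z⁰ − e_{μ₀}`)
  set y₁ : Site P 1 := fun i => if i = μ0 then (((-((M₁ * u : ℕ) : ℤ) - 1 : ℤ)) : ZMod (P.sitesPerDir 1))
    else if i = ν₁ then (((-((M₁ * u : ℕ) : ℤ) : ℤ)) : ZMod (P.sitesPerDir 1)) else 0 with hy₁
  have hsc : ∀ q : ℤ, Site.scaleCoord P 0 ((q : ZMod (P.sitesPerDir 1))) = ((q : ZMod (P.sitesPerDir 0))) * (P.L : ZMod (P.sitesPerDir 0)) := by
    intro q
    have h := map_zsmul (Site.scaleCoord P 0) q (1 : ZMod (P.sitesPerDir 1))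
    rw [Site.scaleCoord_one, zsmul_one, zsmul_eq_mul] at h
    exact h
  have hL2 := Site.two_mul_half_add_one_cast P 0
  have hUL : (U : ZMod (P.sitesPerDir 0)) = (P.L : ZMod (P.sitesPerDir 0)) * (M₁ : ZMod (P.sitesPerDir 0)) * (u : ZMod (P.sitesPerDir 0)) := by
    rw [hU, hs₁]; unfold side; push_cast; ring
  have hy₁0 : y₁ μ0 = (((-((M₁ * u : ℕ) : ℤ) - 1 : ℤ)) : ZMod (P.sitesPerDir 1)) := by rw [hy₁]; exact if_pos rfl
  have hy₁1 : y₁ ν₁ = (((-((M₁ * u : ℕ) : ℤ) : ℤ)) : ZMod (P.sitesPerDir 1)) := by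
    rw [hy₁]; exact (if_neg (Ne.symm hne)).trans (if_pos rfl)
  have hy₁2 : ∀ κ, κ ≠ μ0 → κ ≠ ν₁ → y₁ κ = 0 := fun κ h0 h1 => by rw [hy₁]; exact (if_neg h0).trans (if_neg h1)
  have hx0' : ((cover P w₀).shift ν₁) μ0 = ((-U - 1 : ℤ) : ZMod (P.sitesPerDir 0)) := by
    rw [hsh2]; exact congrArg (fun z : ℤ => (z : ZMod (P.sitesPerDir 0))) (if_pos rfl)
  have hx1' : ((cover P w₀).shift ν₁) ν₁ = ((-U : ℤ) : ZMod (P.sitesPerDir 0)) := by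
    rw [hsh2]; exact congrArg (fun z : ℤ => (z : ZMod (P.sitesPerDir 0))) ((if_neg (Ne.symm hne)).trans (if_pos rfl))
  have hx2' : ∀ κ, κ ≠ μ0 → κ ≠ ν₁ → ((cover P w₀).shift ν₁) κ = ((0 : ℤ) : ZMod (P.sitesPerDir 0)) := fun κ h0 h1 => by
    rw [hsh2]; exact congrArg (fun z : ℤ => (z : ZMod (P.sitesPerDir 0))) ((if_neg h0).trans (if_neg h1))
  refine ⟨⟨cover P w₀, μ0, ν₁, hμν⟩, y₁, rfl, ?_, ?_, ?_, ?_, ?_, ?_⟩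
  · show ((cover P w₀).shift μ0).shift ν₁ ∈ _
    rw [hsh12, key]
    exact corner_mem_maxDom hM hs μ0 ν₁
  · show cover P w₀ ∉ _
    rw [key]
    exact notMem_maxDom_of_coord hM hs hwrap w₀ μ0 (by rw [hw₀]; exact if_pos (Or.inl rfl))
  · show (cover P w₀).shift μ0 ∉ _
    rw [hsh1, key]
    exact notMem_maxDom_of_coord hM hs hwrap _ ν₁ (if_pos rfl)
  · show (cover P w₀).shift ν₁ ∉ _
    rw [hsh2, key]
    exact notMem_maxDom_of_coord hM hs hwrap _ μ0 (if_pos rfl)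
  · show ((cover P w₀).shift ν₁) μ0 = _
    rw [hx0', Site.emb_apply_eq, hy₁0, hsc]
    push_cast
    rw [hUL]
    linear_combination -hL2
  · intro κ hκ
    show ((cover P w₀).shift ν₁) κ + _ = _
    by_cases hκν : κ = ν₁
    · subst hκν
      rw [hx1', Site.emb_apply_eq, hy₁1, hsc]
      push_cast
      rw [hUL]
      ring
    · rw [hx2' κ hκ hκν, Site.emb_apply_eq, hy₁2 κ hκ hκν, map_zero]
      push_cast
      ring

end Corner

/-! ## §2  The LOCAL action of a single-bond field: `A(U₁) ≤ 2d·(dist1 h)²` (no volume letter) -/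

section Action

variable {P : Params} {j : ℕ} {N : ℕ} [NeZero N]

/-- **The Wilson action of the single-bond field is LOCAL**: the field `1` twisted by `h` on the one bond `⟨x, μ₀⟩` (`μ₀` the least direction) has `U(∂p) = 1` on every
plaquette except those `⟨x; μ₀, ν⟩`, `⟨x − e_ν; μ₀, ν⟩` containing the bond — at most `2d` of them (an injection into `Bool × Fin d`), each contributing `1 − Re tr ≤ (dist1 h)²`
([6] (1.10)); so `A(U) ≤ 2d·(dist1 h)²`, independently of the volume (dag-n07-e's `wilsonAction4_le_card_mul_sq` is the volume-dependent form). [cite: Balaban1985RegularSpaces, (1.10) p.77; Balaban1987RG1, (0.2) p.252] -/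
theorem wilsonAction4_single_le (x : Site P j) {μ0 : Fin P.d} (hμ0 : ∀ ν : Fin P.d, ¬ ν < μ0) (h : SU N) :
    wilsonAction4 (fun b : PBond P j => if b.src = x ∧ b.dir = μ0 then h else 1) ≤ 2 * P.d * dist1 h ^ 2 := by
  classical
  set U : GaugeField P j (SU N) := fun b => if b.src = x ∧ b.dir = μ0 then h else 1 with hU
  set S : Finset (Plaq P j) := Finset.univ.filter (fun p => p.μ = μ0 ∧ (p.src = x ∨ p.src.shift p.ν = x)) with hS
  -- off `S` the holonomy is `1`
  have hoff : ∀ p : Plaq P j, p ∉ S → GaugeField.plaqHol U p = 1 := by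
    intro p hp
    have hν : p.ν ≠ μ0 := fun hq => hμ0 p.μ (hq ▸ p.hμν)
    have hp' : ¬ (p.μ = μ0 ∧ (p.src = x ∨ p.src.shift p.ν = x)) := by simpa [hS] using hp
    show (if p.src = x ∧ p.μ = μ0 then h else 1) * (if p.src.shift p.μ = x ∧ p.ν = μ0 then h else 1) *
        (if p.src.shift p.ν = x ∧ p.μ = μ0 then h else 1)⁻¹ * (if p.src = x ∧ p.ν = μ0 then h else 1)⁻¹ = 1
    rw [if_neg (show ¬(p.src.shift p.μ = x ∧ p.ν = μ0) from fun hc => hν hc.2),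
      if_neg (show ¬(p.src = x ∧ p.ν = μ0) from fun hc => hν hc.2),
      if_neg (show ¬(p.src = x ∧ p.μ = μ0) from fun hc => hp' ⟨hc.2, Or.inl hc.1⟩),
      if_neg (show ¬(p.src.shift p.ν = x ∧ p.μ = μ0) from fun hc => hp' ⟨hc.2, Or.inr hc.1⟩)]
    simp
  -- `#S ≤ 2d`
  have hcard : S.card ≤ 2 * P.d := by
    have hmap : ∀ p ∈ S, (fun p : Plaq P j => (decide (p.src = x), p.ν)) p ∈ (Finset.univ : Finset (Bool × Fin P.d)) :=
      fun _ _ => Finset.mem_univ _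
    have hinj : Set.InjOn (fun p : Plaq P j => (decide (p.src = x), p.ν)) S := by
      intro p hp p' hp' hpp
      simp only [hS, Finset.coe_filter, Finset.mem_univ, true_and, Set.mem_setOf_eq] at hp hp'
      simp only [Prod.mk.injEq, decide_eq_decide] at hpp
      obtain ⟨hsrc, hνν⟩ := hpp
      have hμμ : p.μ = p'.μ := hp.1.trans hp'.1.symm
      have hss : p.src = p'.src := by
        by_cases h1 : p.src = x
        · exact h1.trans (hsrc.1 h1).symm
        · have h2 : p.src.shift p.ν = x := hp.2.resolve_left h1
          have h1' : ¬ p'.src = x := fun h => h1 (hsrc.2 h)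
          have h2' : p'.src.shift p'.ν = x := hp'.2.resolve_left h1'
          have h3 : p.src.shift p.ν = p'.src.shift p.ν := by rw [h2, hνν, h2']
          simpa [Site.unshift_shift] using congrArg (fun y => Site.unshift y p.ν) h3
      cases p; cases p'
      simp only at hss hμμ hνν
      subst hss; subst hμμ; subst hνν
      rfl
    have h := Finset.card_le_card_of_injOn _ hmap hinj
    simpa [Fintype.card_prod, Fintype.card_bool, Fintype.card_fin] using h
  -- the sum
  have hterm : ∀ p : Plaq P j, (1 : ℝ) * (1 - reTr (GaugeField.plaqHol U p)) ≤ dist1 h ^ 2 := by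
    intro p
    rw [one_mul]
    exact (cmp_specialUnitaryGroup (n := Fin N) (GaugeField.plaqHol U p)).trans
      (pow_le_pow_left₀ (GaugeGroup.dist1_nonneg _) (dist1_plaqHol_single_le x hμ0 h p) 2)
  have hzero : ∀ p ∈ (Finset.univ : Finset (Plaq P j)), p ∉ S → (1 : ℝ) * (1 - reTr (GaugeField.plaqHol U p)) = 0 := by
    intro p _ hp
    rw [hoff p hp, GaugeGroup.reTr_one]; ring
  unfold wilsonAction4 wilsonAction
  rw [← Finset.sum_subset (Finset.subset_univ S) hzero]
  calc ∑ p ∈ S, (1 : ℝ) * (1 - reTr (GaugeField.plaqHol U p)) ≤ ∑ _p ∈ S, dist1 h ^ 2 := Finset.sum_le_sum fun p _ => hterm p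
    _ = S.card * dist1 h ^ 2 := by rw [Finset.sum_const, nsmul_eq_mul]
    _ ≤ 2 * P.d * dist1 h ^ 2 := by
        have : (S.card : ℝ) ≤ 2 * P.d := by exact_mod_cast hcard
        exact mul_le_mul_of_nonneg_right this (sq_nonneg _)

end Action

/-! ## §3  A (2.12) minimiser over def-R's UNIFORM class `{PlaqSmall θ}` by small-action boundary avoidance -/

section Existence

variable (F : T4Family) {N : ℕ} [NeZero N]

open ExpMeanLog (deltaSU)

/-- ★ **SMALL-ACTION BOUNDARY AVOIDANCE FOR def-R's UNIFORM CLASS.**  On the torus `F.P K`, for the class `{U | |U(∂q) − 1| < θ ∀q}` (def-R's v1 χ-class literal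
`{PlaqSmall (εreg·η²)}` of `Node00.chiOfRecord`, here with a generic threshold `0 ≤ θ < α₀η_k²`, `α₀` (53)-admissible so that the averagings of record are continuous on the
closure), any determining set `genSet Ω k` and datum `W`: if the fibre `{M_𝐁(U) = W}` holds some `U₁` of the class with `2N·A(U₁) < θ²`, then (2.12) over the class HAS a
minimal configuration (dag-n07-e's `exists_isMinimizer_holes_of_smallAction`, re-keyed: the direct method over the CLOSED class `closure {PlaqSmall θ} ⊆ bgReg … k α₀`, then
every plaquette of the closed-class minimiser has `dist1² ≤ 2N·A ≤ 2N·A(U₁) < θ²`).  Volume enters only through the hypothesis. [cite: Balaban1988Convergent, (2.12) p.256, (2.17) p.257; Balaban1985RegularSpaces, (1.10) p.77] -/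
theorem exists_isMinimizer_plaqSmall_of_smallAction (K k : ℕ) (Ω : ℕ → Set (Site (F.P K) 0)) {α₀ θ : ℝ} (hα : 0 < α₀)
    (hα3 : (143 * (((((F.P K).d + 4 : ℕ) : ℝ)) ^ 2 / 4) ^ 2) * α₀ ≤ 1 / 3)
    (hα2 : 2 * α₀ ≤ 2 * deltaSU (Fin N) / ((((F.P K).d + 4) * (F.P K).L : ℕ) : ℝ) ^ 2)
    (hθ0 : 0 ≤ θ) (hθ : θ < α₀ * (F.P K).eta k ^ 2)
    {W : MSField (F.P K) (SU N)} {U₁ : GaugeField (F.P K) 0 (SU N)} (hU₁ : PlaqSmall θ U₁)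
    (hA : AgreeOn (genSet Ω k) (avgFamily (avOfRecord F N K) U₁) W) (hact : 2 * N * wilsonAction4 U₁ < θ ^ 2) :
    ∃ U₀ : GaugeField (F.P K) 0 (SU N), IsMinimizer (avOfRecord F N K) {U | PlaqSmall θ U} (genSet Ω k) W U₀ := by
  have hsub : closure {U : GaugeField (F.P K) 0 (SU N) | PlaqSmall θ U} ⊆ bgReg F N K k α₀ :=
    closure_plaqSmall_subset_plaqSmall hθ
  have h𝔹 : ∀ j, k < j → genSet Ω k j = ∅ := by
    intro j hj
    show pts j (gammaRegion Ω k j) = ∅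
    rw [gammaRegion_of_gt Ω hj]
    rfl
  obtain ⟨U₀, hmin⟩ := exists_isMinimizer_of_isClosed (F := F) K k hα hα3 hα2 isClosed_closure hsub
    (genSet Ω k) h𝔹 ⟨U₁, subset_closure hU₁, hA⟩
  have hAct : wilsonAction4 U₀ ≤ wilsonAction4 U₁ := hmin.2.2 U₁ (subset_closure hU₁) hA
  have hN : (0 : ℝ) ≤ 2 * N := by positivity
  have hlt : 2 * N * wilsonAction4 U₀ < θ ^ 2 := (mul_le_mul_of_nonneg_left hAct hN).trans_lt hact
  exact ⟨U₀, isMinimizer_of_isMinimizer_closure_of_mem hmin fun q => dist1_plaqHol_lt_of_wilsonAction4_lt hθ0 hlt q⟩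

end Existence


end Summit.QuantumFields.YangMills.BalabanUVNodes.N20LCSChiClassSocketCorner

end
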